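import Literature.Computability.AlgebraicComplexity.BI17LatinCubeCountTwo
import Literature.Computability.AlgebraicComplexity.BI17AdmissibleTablesProofs
import Literature.Computability.AlgebraicComplexity.BI17DetPerMinimalDegreeProofs
import HarnessLib

/-!
# Latin cubes are admissible tables: BI 2017 Problem 5.23 ⟺ `P_{n,n²}(det_n) ≠ 0` ⟺ `e(det_n) = n²`

Cell `val-lit` (D-0074 GROUP L), BIP corpus, unit val-lit-t03-g6; GAP-LEDGER rows BI2017-A
(`BI2017_P416_det_per`) and BI2017-B (`BI2017_latinCube_2_4`) of the V3 menu (`bears_on`: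
`Summit.PneNP.GCT.MultObstructionPer3Det4`, stmt-ValiantsHypothesis-19612 — as bookkeeping of the
BI 2017 toy invariants only). A new (elementary) result, hence filed under `Summits/…/Theorems/`, not
`Literature/`. Theorems and explicit conversion maps only: NO named facts, no instances, no notation,
unconditional (no BI17 named fact is assumed; three DISCHARGED ones are used by name). HONEST FRAMING:
VP ≠ VNP is NOT proved here or anywhere in the tree and nothing in this file is progress on it.

Source: P. Bürgisser, C. Ikenmeyer, *Fundamental invariants of orbit closures*, J. Algebra 477 (2017)
= arXiv:1511.02927 [BurgisserIkenmeyer2017]. The source evaluates its two "fundamental invariants"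
combinatorially and SEPARATELY:
* Prop. 3.28 (§3.3, TeX L1501): `P_{n,n²}(det_n) = #{even} − #{odd admissible n-tables}` (up to the
  factor `(n!)^{n²}` of the tree's normalisation; `BI2017_prop_3_28_holds`), followed by "for
  geometric complexity theory it would be important to know whether `P_{n,n²}` vanishes on `det_n`",
  i.e. whether `e(det_n) = n²` (Prop. 3.25(2), `BI2017_minimalDegree_det_per_holds`), checked by
  computer for `n = 2, 4` (eq. (3.9), fact `BI2017_P416_det_per`);
* Prop. 5.22 / Def. 5.21 / Problem 5.23 (§5.2, TeX L2422–2457): `F_n(⟨n²⟩) = #{even} − #{odd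
  Latin cubes of size n}` (`BI2017_prop_5_22_holds`); "The following question, which is analogous
  to the Alon–Tarsi conjecture, is important for understanding tensor border rank. We have verified
  this in the cases `n = 2` and `n = 4`" (fact `BI2017_latinCube_2_4`).

**This file proves that the two counts are the same count.** An admissible `n`-table `(S,T)`
(rows of `S`, `T` permutations of `[n]`, every column `i ↦ (S(i,j),T(i,j))` a bijection
`[n²] → [n]×[n]`) IS a Latin cube of size `n`: put the symbol `i` (the table row) at the cells
`(S(i,z), T(i,z), z)`, `z ∈ [n]` — a "3D diagonal"; column-bijectivity is `z`-slice bijectivity,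
and the rows of `S` (resp. `T`) being permutations is `x`- (resp. `y`-) slice bijectivity
(`cubeOfTable`, `tableOfCube`, `isLatinCube_cubeOfTable`, `isAdmissibleTable_tableOfCube`, the two
inverse laws). Under this bijection the signs agree up to a FIXED sign (`latinCubeSign_cubeOfTable`):
* the `z`-slice maps are the inverses of the column bijections, so `sgn_z = csgn(S,T)`
  (`labelSignZ_cubeOfTable`);
* `rsgn(S)·rsgn(T) = ∏_i sgn(π_i)` with `π_i = T(i,·)∘S(i,·)⁻¹` the pattern of the `i`-th diagonal
  (`tableRowSign_mul_tableRowSign`);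
* `sgn_x · sgn_y = sign(twist_n) · ∏_i sgn(π_i)` (`labelSignX_mul_labelSignY`): the block
  permutation `(r,i) ↦ (r, x-position of i in slice r)` of `[n]×[n²]` factors as
  `twist_n ∘ ((c,i) ↦ (c, y-position)) ∘ ((r,i) ↦ (π_i r, i))` (`prodCongrRight_posX`), and
  Mathlib's `sign_prodCongrRight/Left` read off the three signs; `twist_n` is the fixed involution
  `(a, (b,z)) ↦ (b, (a,z))`, of sign `sign(swap on [n]×[n])^n` (`sign_twist`), `= 1` for even `n`.
Hence (`latinCubeCount_eq_sign_twist_mul_admissibleTableCount`,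
`latinCubeCount_eq_admissibleTableCount_of_even`, `latinCubeCount_ne_zero_iff`)
`#{even} − #{odd Latin cubes of size n} = sign(twist_n)·(#{even} − #{odd admissible n-tables})`,
and with the tree's discharged Props 3.25, 3.28, 5.22:
* `fundInvariantTensor_unitTensor_eq_cayleyP_det`: `F_n(⟨n²⟩) = ±(n!)^{n²}·P_{n,n²}(det_n)`;
* **`latinCubeQuestion_iff_minimalDegree_det`** (`2 ≤ n`): BI Problem 5.23 holds for `n` iff
  `e(det_n) = n²` iff `P_{n,n²}(det_n) ≠ 0` (`latinCubeQuestion_iff_cayleyP_det_ne_zero`);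
* the two computational facts of the tree are one: `BI2017_latinCube_2_4 ↔ P_{4,16}(det_4) ≠ 0`
  (`BI2017_latinCube_2_4_iff_cayleyP_det_four`, `…_iff_admissibleTableCount_four`; the `n = 2`
  conjunct is the theorem `latinCubeCount_two_ne_zero`), `BI2017_P416_det_per → BI2017_latinCube_2_4`
  (`BI2017_latinCube_2_4_of_P416`), `BI2017_latinCube_2_4 → e(det_4) = 16`.
Neither BI 2017 nor Amanov–Yeliussizov (IMRN 2023, arXiv:2202.11059 §7.3, where the Latin-cube count
is `AT₃(n)` and "in [BI] it is also noted that computations show `AT₃(4) ≠ 0`") state this link; the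
nearest printed item, Li–Zhang–Xia (LAA, arXiv:2111.07343) §5, attaches to each symbol `s` of a Latin
cube its 3D permutation matrix `P_s = {(i, σ(i), τ(i))}` (the diagonal above) and the "symbol sign"
`∏_s sgn(σ_{P_s}) sgn(τ_{P_s})` (`= rsgn(T)` in the table language), and poses as Problem 5.7 the
relation between the symbol-parity and the slice-parity counts — a different pairing from the one
settled here. The link is elementary and recorded as [folklore] (val-lit presearch, lit g8 03:23Z:
not found in print). Numbers of record (val-lit NOTE-t03g6-P416-sizing.md,
exact meet-in-the-middle enumeration, not kernel-certified): `#{normalized Latin cubes of size 4} =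
368 436 584 448`, `|latinCubeCount 4| = 16!·109 734 912 000`, `P_{4,16}(det_4) = 5364734375/28311552`.

## References

* [BurgisserIkenmeyer2017] P. Bürgisser, C. Ikenmeyer, arXiv:1511.02927, §3.3 (admissible tables,
  Prop. 3.28, eq. (3.9)), Prop. 3.25, §5.2 (Def. 5.21, Prop. 5.22, Problem 5.23).
* A. Amanov, D. Yeliussizov, *Fundamental invariants of tensors, Latin hypercubes, and rectangular
  Kronecker coefficients*, IMRN 2023, arXiv:2202.11059, §7.3 (context only).
* X. Li, L. Zhang, H. Xia, *Two classes of minimal generic fundamental invariants for tensors*,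
  Linear Algebra Appl., arXiv:2111.07343, §5 (Prop. 5.1, Prop. 5.6, Problem 5.7; context only).

## Tree

`IsAdmissibleTable`, `tableRowSign`, `tableColSign`, `admissibleTableCount`, `BI2017_prop_3_28`,
`BI2017_minimalDegree_det_per`, `BI2017_P416_det_per` (`BI17FundamentalInvariantForms`);
`IsLatinCube`, `x/y/zSliceMap`, `sliceSign`, `labelSignX/Y/Z`, `latinCubeSign`, `latinCubeCount`,
`latinCubeQuestion`, `BI2017_prop_5_22(_holds)`, `BI2017_latinCube_2_4` (`BI17FundamentalInvariantTensors`);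
`latinCubeCount_two_ne_zero` (`BI17LatinCubeCountTwo`); `BI2017_prop_3_28_holds`
(`BI17AdmissibleTablesProofs`); `BI2017_minimalDegree_det_per_holds` (`BI17DetPerMinimalDegreeProofs`);
`Kumar2015.seqSign`, `seqSign_coe_perm` (`KumarLatinRectangles`). Mathlib: `finProdFinEquiv`,
`Fintype.bijInv`, `Equiv.ofBijective`, `Equiv.prodCongrLeft/Right`, `Equiv.Perm.sign_prodCongrLeft/Right`,
`Equiv.Perm.sign_trans_trans`, `Finset.sum_nbij'`, `Int.units_eq_one_or`.

FILE SPLIT (gate rule: Theorems files with proofs ≤ 400 lines): this is PART 1 of 2 — the conversion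
`cubeOfTable` / `tableOfCube`, the slice maps and slice signs of the cube of an admissible table.
PART 2 (`BI17LatinCubesAdmissibleTablesCount.lean`): the twist and its sign, the sign formula
`latinCubeSign_cubeOfTable`, the inverse laws, the signed counts and the consequences / edges listed
above. Typed by val-lit-t03 g6; filed verbatim (split only) by prover val-lit-p4 g5.
-/

namespace Summit.ValiantsHypothesis.BI17LatinCubesAdmissibleTables

open Finset Equiv Literature.Computability.AlgebraicComplexity

variable {n : ℕ}

/-! ### From an admissible table to a labeling of the cube -/

open scoped Classical in
/-- The labeling of the combinatorial cube `[n]³` attached to a table `(S,T)`: the cell `(r, c, z)`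
carries the symbol `i` (the table row) with `(S(i,z), T(i,z)) = (r, c)`, i.e. symbol `i` occupies the
"diagonal" `{(S(i,z), T(i,z), z) : z ∈ [n]}`; defined through `Fintype.bijInv` of the column maps
(junk value when the column `z` of the table is not a bijection). [folklore] -/
noncomputable def cubeOfTable (S T : Fin (n * n) → Fin n → Fin n) :
    Fin n × Fin n × Fin n → Fin (n * n) := fun p =>
  if h : Function.Bijective (fun i : Fin (n * n) => (S i p.2.2, T i p.2.2)) then
    Fintype.bijInv h (p.1, p.2.1)
  else finProdFinEquiv (p.1, p.2.1)

open scoped Classical in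
/-- The table attached to a labeling `α : [n]³ → [n²]`: `S(i,z)` and `T(i,z)` are the row and the
column of the cell of the `z`-slice carrying the symbol `i` (junk when that slice is not a
bijection). [folklore] -/
noncomputable def tableOfCube (n : ℕ) (α : Fin n × Fin n × Fin n → Fin (n * n)) :
    (Fin (n * n) → Fin n → Fin n) × (Fin (n * n) → Fin n → Fin n) :=
  (fun i z =>
      if h : Function.Bijective (zSliceMap n α z) then
        (finProdFinEquiv.symm ((Equiv.ofBijective _ h).symm i)).1
      else (finProdFinEquiv.symm i).1,
    fun i z =>
      if h : Function.Bijective (zSliceMap n α z) then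
        (finProdFinEquiv.symm ((Equiv.ofBijective _ h).symm i)).2
      else (finProdFinEquiv.symm i).2)

section Table

variable {S T : Fin (n * n) → Fin n → Fin n} (h : IsAdmissibleTable S T)
include h

/-- The defining property of `cubeOfTable`: the symbol at `(r, c, z)` is the table row `i` with
`(S(i,z), T(i,z)) = (r, c)`. [folklore] -/
theorem cubeOfTable_spec (r c z : Fin n) :
    S (cubeOfTable S T (r, c, z)) z = r ∧ T (cubeOfTable S T (r, c, z)) z = c := by
  have hb := h.2.2 z
  have := Fintype.rightInverse_bijInv hb (r, c)
  simp only [cubeOfTable, dif_pos hb]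
  exact ⟨congrArg Prod.fst this, congrArg Prod.snd this⟩

/-- Uniqueness: if `(S(i,z), T(i,z)) = (r,c)` then the symbol at `(r,c,z)` is `i`. [folklore] -/
theorem cubeOfTable_eq_of {r c z : Fin n} {i : Fin (n * n)} (hr : S i z = r) (hc : T i z = c) :
    cubeOfTable S T (r, c, z) = i := by
  have hb := h.2.2 z
  apply hb.1
  have h1 := cubeOfTable_spec h r c z
  simp only [Prod.mk.injEq]
  exact ⟨h1.1.trans hr.symm, h1.2.trans hc.symm⟩

/-- The row permutations `S(i,·)`, `T(i,·)` of an admissible table, as permutations. [folklore] -/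
noncomputable def rowPermS (i : Fin (n * n)) : Equiv.Perm (Fin n) := Equiv.ofBijective (S i) (h.1 i)
/-- See `rowPermS`. [folklore] -/
noncomputable def rowPermT (i : Fin (n * n)) : Equiv.Perm (Fin n) := Equiv.ofBijective (T i) (h.2.1 i)

/-- The permutation pattern `π_i = T(i,·) ∘ S(i,·)⁻¹` of the `i`-th row (row ↦ column of the
diagonal of the symbol `i`). [folklore] -/
noncomputable def pat (i : Fin (n * n)) : Equiv.Perm (Fin n) := (rowPermS h i).symm.trans (rowPermT h i)

/-- The column bijection `i ↦ (S(i,z), T(i,z))` of an admissible table read in `[n²]` through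
`finProdFinEquiv`, as a permutation. [folklore] -/
noncomputable def colPerm (z : Fin n) : Equiv.Perm (Fin (n * n)) :=
  Equiv.ofBijective (fun i => finProdFinEquiv (S i z, T i z)) (finProdFinEquiv.bijective.comp (h.2.2 z))

/-- Position of the symbol `i` in the `x`-slice `r`: `(c, z) = (T(i,z), S(i,·)⁻¹ r)` read in `[n²]`. [folklore] -/
noncomputable def posXFun (r : Fin n) (i : Fin (n * n)) : Fin (n * n) :=
  finProdFinEquiv (T i ((rowPermS h i).symm r), (rowPermS h i).symm r)

/-- Position of the symbol `i` in the `y`-slice `c`: `(r, z) = (S(i,z), T(i,·)⁻¹ c)` read in `[n²]`. [folklore] -/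
noncomputable def posYFun (c : Fin n) (i : Fin (n * n)) : Fin (n * n) :=
  finProdFinEquiv (S i ((rowPermT h i).symm c), (rowPermT h i).symm c)

/-- Distinct symbols occupy distinct cells of an `x`-slice. [folklore] -/
theorem posXFun_injective (r : Fin n) : Function.Injective (posXFun h r) := by
  intro i j hij
  unfold posXFun at hij
  have hij' := finProdFinEquiv.injective hij
  simp only [Prod.mk.injEq] at hij'
  obtain ⟨hT, hz⟩ := hij'
  have hSi : S i ((rowPermS h i).symm r) = r := Equiv.ofBijective_apply_symm_apply (S i) (h.1 i) r
  have hSj : S j ((rowPermS h j).symm r) = r := Equiv.ofBijective_apply_symm_apply (S j) (h.1 j) r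
  apply (h.2.2 ((rowPermS h i).symm r)).1
  simp only [Prod.mk.injEq]
  refine ⟨?_, ?_⟩
  · rw [hSi]; conv_rhs => rw [hz]
    rw [hSj]
  · rw [hT]; conv_rhs => rw [hz]

/-- Distinct symbols occupy distinct cells of a `y`-slice. [folklore] -/
theorem posYFun_injective (c : Fin n) : Function.Injective (posYFun h c) := by
  intro i j hij
  unfold posYFun at hij
  have hij' := finProdFinEquiv.injective hij
  simp only [Prod.mk.injEq] at hij'
  obtain ⟨hS, hz⟩ := hij'
  have hTi : T i ((rowPermT h i).symm c) = c := Equiv.ofBijective_apply_symm_apply (T i) (h.2.1 i) c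
  have hTj : T j ((rowPermT h j).symm c) = c := Equiv.ofBijective_apply_symm_apply (T j) (h.2.1 j) c
  apply (h.2.2 ((rowPermT h i).symm c)).1
  simp only [Prod.mk.injEq]
  refine ⟨?_, ?_⟩
  · rw [hS]; conv_rhs => rw [hz]
  · rw [hTi]; conv_rhs => rw [hz]
    rw [hTj]

/-- `posXFun` as a permutation of `[n²]`. [folklore] -/
noncomputable def posX (r : Fin n) : Equiv.Perm (Fin (n * n)) :=
  Equiv.ofBijective (posXFun h r) (Finite.injective_iff_bijective.mp (posXFun_injective h r))
/-- `posYFun` as a permutation of `[n²]`. [folklore] -/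
noncomputable def posY (c : Fin n) : Equiv.Perm (Fin (n * n)) :=
  Equiv.ofBijective (posYFun h c) (Finite.injective_iff_bijective.mp (posYFun_injective h c))

/-- The `x`-slices of the cube of an admissible table are the inverses of the position maps. [folklore] -/
theorem xSliceMap_cubeOfTable (r : Fin n) : xSliceMap n (cubeOfTable S T) r = ⇑(posX h r).symm := by
  funext q
  rw [eq_comm, Equiv.symm_apply_eq]
  -- `q = posX (α (r, e⁻¹ q))`
  set c := (finProdFinEquiv.symm q).1
  set z := (finProdFinEquiv.symm q).2
  have hspec := cubeOfTable_spec h r c z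
  set i := cubeOfTable S T (r, c, z)
  have hz : (rowPermS h i).symm r = z := by
    rw [Equiv.symm_apply_eq]; exact hspec.1.symm
  show q = finProdFinEquiv (T i ((rowPermS h i).symm r), (rowPermS h i).symm r)
  rw [hz, hspec.2]
  exact (finProdFinEquiv.apply_symm_apply q).symm

/-- The `y`-slices likewise. [folklore] -/
theorem ySliceMap_cubeOfTable (c : Fin n) : ySliceMap n (cubeOfTable S T) c = ⇑(posY h c).symm := by
  funext q
  rw [eq_comm, Equiv.symm_apply_eq]
  set r := (finProdFinEquiv.symm q).1
  set z := (finProdFinEquiv.symm q).2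
  have hspec := cubeOfTable_spec h r c z
  set i := cubeOfTable S T (r, c, z)
  have hz : (rowPermT h i).symm c = z := by
    rw [Equiv.symm_apply_eq]; exact hspec.2.symm
  show q = finProdFinEquiv (S i ((rowPermT h i).symm c), (rowPermT h i).symm c)
  rw [hz, hspec.1]
  exact (finProdFinEquiv.apply_symm_apply q).symm

/-- The `z`-slices are the inverses of the column permutations. [folklore] -/
theorem zSliceMap_cubeOfTable (z : Fin n) : zSliceMap n (cubeOfTable S T) z = ⇑(colPerm h z).symm := by
  funext q
  rw [eq_comm, Equiv.symm_apply_eq]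
  set r := (finProdFinEquiv.symm q).1
  set c := (finProdFinEquiv.symm q).2
  have hspec := cubeOfTable_spec h r c z
  set i := cubeOfTable S T (r, c, z)
  show q = finProdFinEquiv (S i z, T i z)
  rw [hspec.1, hspec.2]
  exact (finProdFinEquiv.apply_symm_apply q).symm

/-- The cube of an admissible table is a Latin cube. [folklore] -/
theorem isLatinCube_cubeOfTable : IsLatinCube n (cubeOfTable S T) := by
  refine ⟨fun r => ?_, fun c => ?_, fun z => ?_⟩
  · rw [xSliceMap_cubeOfTable h]; exact (posX h r).symm.bijective
  · rw [ySliceMap_cubeOfTable h]; exact (posY h c).symm.bijective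
  · rw [zSliceMap_cubeOfTable h]; exact (colPerm h z).symm.bijective

/-! ### Slice signs of the cube of an admissible table -/

/-- `z`-slice signs = column signs. [folklore] -/
theorem labelSignZ_cubeOfTable :
    labelSignZ n (cubeOfTable S T) = ((tableColSign S T : ℤˣ) : ℤ) := by
  have hbij : ∀ ℓ, Function.Bijective (zSliceMap n (cubeOfTable S T) ℓ) := fun ℓ => by
    rw [zSliceMap_cubeOfTable h]; exact (colPerm h ℓ).symm.bijective
  rw [labelSignZ, sliceSign, if_pos hbij, tableColSign, Units.coe_prod]
  refine Finset.prod_congr rfl fun ℓ _ => ?_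
  rw [zSliceMap_cubeOfTable h, Kumar2015.seqSign_coe_perm, Equiv.Perm.sign_symm]
  have : (fun i => finProdFinEquiv (S i ℓ, T i ℓ)) = ⇑(colPerm h ℓ) := rfl
  rw [this, Kumar2015.seqSign_coe_perm]

/-- Row signs: `rsgn(S) · rsgn(T) = ∏_i sgn(π_i)`. [folklore] -/
theorem tableRowSign_mul_tableRowSign :
    tableRowSign S * tableRowSign T = ∏ i, Equiv.Perm.sign (pat h i) := by
  rw [tableRowSign, tableRowSign, ← Finset.prod_mul_distrib]
  refine Finset.prod_congr rfl fun i _ => ?_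
  have hS : (S i) = ⇑(rowPermS h i) := rfl
  have hT : (T i) = ⇑(rowPermT h i) := rfl
  rw [hS, hT, Kumar2015.seqSign_coe_perm, Kumar2015.seqSign_coe_perm, pat, Equiv.Perm.sign_trans,
    Equiv.Perm.sign_symm, mul_comm]

/-- `x`-slice signs through the position permutations. [folklore] -/
theorem labelSignX_cubeOfTable :
    labelSignX n (cubeOfTable S T) = ((∏ r, Equiv.Perm.sign (posX h r) : ℤˣ) : ℤ) := by
  have hbij : ∀ ℓ, Function.Bijective (xSliceMap n (cubeOfTable S T) ℓ) := fun ℓ => by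
    rw [xSliceMap_cubeOfTable h]; exact (posX h ℓ).symm.bijective
  rw [labelSignX, sliceSign, if_pos hbij, Units.coe_prod]
  refine Finset.prod_congr rfl fun ℓ _ => ?_
  rw [xSliceMap_cubeOfTable h, Kumar2015.seqSign_coe_perm, Equiv.Perm.sign_symm]

/-- `y`-slice signs through the position permutations. [folklore] -/
theorem labelSignY_cubeOfTable :
    labelSignY n (cubeOfTable S T) = ((∏ c, Equiv.Perm.sign (posY h c) : ℤˣ) : ℤ) := by
  have hbij : ∀ ℓ, Function.Bijective (ySliceMap n (cubeOfTable S T) ℓ) := fun ℓ => by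
    rw [ySliceMap_cubeOfTable h]; exact (posY h ℓ).symm.bijective
  rw [labelSignY, sliceSign, if_pos hbij, Units.coe_prod]
  refine Finset.prod_congr rfl fun ℓ _ => ?_
  rw [ySliceMap_cubeOfTable h, Kumar2015.seqSign_coe_perm, Equiv.Perm.sign_symm]

end Table

end Summit.ValiantsHypothesis.BI17LatinCubesAdmissibleTables
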